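/-
Copyright (c) 2026. All rights reserved.
Released under Apache 2.0 license as described in the file LICENSE.
Authors: abc-iut cell, block C / W6 prover seat abc-iut-w6-d060 (gen 3).
-/
import Literature.IUT.LogVolume.UnitLogFirstTieLevelRoots
import HarnessLib

/-!
# `log_p(𝒪_K^×)` at the FIRST TIE LEVEL, IIb: `K ∋ ζ_p ⟺ ∃ x, ‖x^{p−1} + p‖ < ‖p‖` — for EVERY finite `K/ℚ_p`, `p` odd

PROOF-ONLY sequel (no `def`, no named fact) of `UnitLogFirstTieLevelRoots.lean` (abc-iut-w6-d060): the
root-of-unity criterion of §5 there (`K ∋ ζ_p ≠ 1 ⟺` the residue polynomial `ā ↦ ā + c̄·ā^p`, `c = ϖ^{s(p−1)}/p`,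
has a unit zero, at a field with `e = s(p−1)`) in the UNIFORMIZER-FREE `x`-form, and then with the hypothesis on
`e` REMOVED:

* (private, `e = s(p−1)`) `∃ ζ, ζ^p = 1 ≠ ζ ⟺ ∃ x, ‖x^{p−1} + p‖ < ‖p‖` (`x = ϖˢa`: `x^{p−1} + p = p·(c·a^{p−1} + 1)`,
  `a + c·a^p = a·(c·a^{p−1} + 1)`);
* **`exists_isPrimitiveRoot_iff_exists_norm_pow_add_lt`**: for ANY proper ultrametric normed `ℚ_p`-algebra field
  `K`, `p` odd: **`(∃ ζ ∈ K, ζ` a primitive `p`-th root of unity`) ⟺ ∃ x ∈ K, ‖x^{p−1} + p‖ < ‖p‖`** — `−p` is a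
  `(p−1)`-th power to first order iff `ζ_p ∈ K` (`ℚ_p(ζ_p) = ℚ_p((−p)^{1/(p−1)})`).  Either side forces
  `(p − 1) ∣ e` (abc-iut-w5-d039's `pred_dvd_absRamificationIdx_of_isPrimitiveRoot`, resp. `‖x‖^{p−1} = ‖p‖ = ‖ϖ‖ᵉ`),
  whereupon the tie-level criterion applies with `s = e/(p−1)`.  The case `e = p − 1` is this seat's
  `BoundaryRamification.exists_pow_prime_eq_one_ne_one_iff_exists_norm_pow_add_lt` (whose hypothesis is thus removed).

Consumer (record only; D-0079 R-W lane U): the one residue bit «`ζ_p ∈ K_w`?» that decides the inner radius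
`r_in ∈ {s, s+1}` of `log_p(𝒪^×_{K_w})` at places with `(p−1) ∣ e_w`, `p ∤ e_w` (`UnitLogFirstTieLevelInnerRadius`)
is the solubility of `‖x^{p−1} + p‖ < ‖p‖` in `K_w` — a finite residue computation.
References: [cite: NeukirchANT1999, Ch. II Prop. (5.7), (7.13)] [cite: Washington1997, Lemma 1.4, §5.1].
Nothing here is disputed mathematics; no IUT statement is asserted; no side is taken on [IUTchIII] Cor. 3.12 or on
any author.
-/

noncomputable section

open Metric Set IsUltrametricDist IsLocalRing
open scoped Pointwise NormedField

namespace Literature.IUT.LogVolume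

open Literature.NumberTheory.GaloisRepresentations.Ultrametric Literature.NumberTheory.Transcendental
  BoundaryRamification

namespace FirstTieLevel

variable (p : ℕ) [hp : Fact p.Prime]
variable {K : Type*} [NontriviallyNormedField K] [instK : NormedAlgebra ℚ_[p] K] [IsUltrametricDist K]
  [ProperSpace K]

/-! ## 5a. The `x`-form at a tie-level field -/

section RootsX

variable {ϖ : Kˣ} (hϖ : IsUniformizer ϖ) {s : ℕ} (he : absRamificationIdx p K = s * (p - 1))
include hϖ he

/-- The criterion in `x`-form at a tie-level field (`e = s(p−1)`): `K ∋ ζ_p ≠ 1 ⟺ ∃ x ∈ K, ‖x^{p−1} + p‖ < ‖p‖`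
(`x = ϖˢa`: `x^{p−1} + p = p·(c·a^{p−1} + 1)` and `a + c·a^p = a·(c·a^{p−1} + 1)`).  Private: the hypothesis
`e = s(p−1)` is REMOVED in `exists_isPrimitiveRoot_iff_exists_norm_pow_add_lt` below, which is the form to cite
(the case `s = 1` is this seat's `BoundaryRamification.exists_pow_prime_eq_one_ne_one_iff_exists_norm_pow_add_lt`).
[cite: NeukirchANT1999, Ch. II Prop. (5.7)] [cite: Washington1997, Lemma 1.4] -/
private theorem exists_pow_prime_eq_one_ne_one_iff_exists_norm_pow_add_lt_level (hp2 : p ≠ 2) :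
    (∃ ζ : K, ζ ^ p = 1 ∧ ζ ≠ 1) ↔ ∃ x : K, ‖x ^ (p - 1) + p‖ < ‖(p : K)‖ := by
  have hp0 : (p : K) ≠ 0 := prime_ne_zero p K
  have hpn : 0 < ‖(p : K)‖ := norm_pos_iff.mpr hp0
  have hϖ0 : (ϖ : K) ^ s ≠ 0 := pow_ne_zero _ ϖ.ne_zero
  have hπ := norm_pow_level_pow_eq p hϖ he
  have hc1 : ‖((ϖ : K) ^ s) ^ (p - 1) / p‖ = 1 := norm_coeff_eq_one p hπ
  have hpp : ‖(p : K)‖ = ‖(ϖ : K) ^ s‖ ^ (p - 1) := norm_prime_eq_pow_of_pow_eq p hπ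
  -- the identity `x^{p-1} + p = p · c⁻¹ ·(...)`: we use `a·(a^{p-1}·c + 1) = a + c·a^p`
  rw [exists_pow_prime_eq_one_ne_one_iff_exists_unit_zero p hϖ he hp2]
  constructor
  · rintro ⟨a, ha, hΛ⟩
    refine ⟨(ϖ : K) ^ s * a, ?_⟩
    -- `x^{p-1} + p = p·(c·a^{p-1} + 1)` and `a + c a^p = a·(1 + c a^{p-1})`
    have hid : ((ϖ : K) ^ s * a) ^ (p - 1) + p = (p : K) * (((ϖ : K) ^ s) ^ (p - 1) / p * a ^ (p - 1) + 1) := by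
      field_simp
      ring
    have hid2 : a + ((ϖ : K) ^ s) ^ (p - 1) / p * a ^ p = a * (((ϖ : K) ^ s) ^ (p - 1) / p * a ^ (p - 1) + 1) := by
      have hpow : a ^ p = a ^ (p - 1) * a := by
        rw [← pow_succ, Nat.sub_add_cancel hp.out.one_lt.le]
      rw [hpow]
      ring
    rw [hid2, norm_mul, ha, one_mul] at hΛ
    rw [hid, norm_mul]
    exact mul_lt_of_lt_one_right hpn hΛ
  · rintro ⟨x, hx⟩
    -- `‖x‖ = ‖ϖ‖ˢ`: from `‖x^{p-1} + p‖ < ‖p‖`, `‖x^{p-1}‖ = ‖p‖`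
    have hxn : ‖x ^ (p - 1)‖ = ‖(p : K)‖ := by
      have h := norm_add_eq_max_of_norm_ne_norm (x := x ^ (p - 1) + p) (y := -(p : K))
        (by rw [norm_neg]; exact hx.ne)
      rw [add_neg_cancel_right, norm_neg, max_eq_right hx.le] at h
      exact h
    have hq0 : p - 1 ≠ 0 := by have := hp.out.two_le; omega
    have hxs : ‖x‖ = ‖(ϖ : K) ^ s‖ := by
      rw [norm_pow, hpp] at hxn
      exact (pow_left_inj₀ (norm_nonneg _) (norm_nonneg _) hq0).mp hxn
    set a : K := x / (ϖ : K) ^ s with ha_def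
    have ha : ‖a‖ = 1 := by
      rw [ha_def, norm_div, hxs, div_self (norm_ne_zero_iff.mpr hϖ0)]
    have hxa : x = (ϖ : K) ^ s * a := by rw [ha_def, mul_div_cancel₀ _ hϖ0]
    refine ⟨a, ha, ?_⟩
    have hid : ((ϖ : K) ^ s * a) ^ (p - 1) + p = (p : K) * (((ϖ : K) ^ s) ^ (p - 1) / p * a ^ (p - 1) + 1) := by
      field_simp
      ring
    have hid2 : a + ((ϖ : K) ^ s) ^ (p - 1) / p * a ^ p = a * (((ϖ : K) ^ s) ^ (p - 1) / p * a ^ (p - 1) + 1) := by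
      have hpow : a ^ p = a ^ (p - 1) * a := by
        rw [← pow_succ, Nat.sub_add_cancel hp.out.one_lt.le]
      rw [hpow]
      ring
    rw [hxa, hid, norm_mul] at hx
    rw [hid2, norm_mul, ha, one_mul]
    exact lt_of_mul_lt_mul_left (by rwa [mul_one]) hpn.le


end RootsX

/-! ## 5b. The root-of-unity criterion WITHOUT hypothesis on `e` -/

section RootsAnyIndex

/-- **`K` contains a primitive `p`-th root of unity ⟺ ∃ x ∈ K, ‖x^{p−1} + p‖ < ‖p‖`** (`p` odd; `K` ANY finite
extension of `ℚ_p`, NO hypothesis on `e`): `−p` is a `(p−1)`-th power «to first order» iff `ζ_p ∈ K`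
(`ℚ_p(ζ_p) = ℚ_p((−p)^{1/(p−1)})`).  Either side forces `(p − 1) ∣ e` (abc-iut-w5-d039's
`pred_dvd_absRamificationIdx_of_isPrimitiveRoot`, resp. `‖x‖^{p−1} = ‖p‖ = ‖ϖ‖ᵉ`), and then the tie-level
criterion (§5, `s = e/(p−1)`) applies.  The case `e = p − 1` is this seat's
`BoundaryRamification.exists_pow_prime_eq_one_ne_one_iff_exists_norm_pow_add_lt`; this removes its hypothesis.
[cite: NeukirchANT1999, Ch. II Prop. (5.7), (7.13)] [cite: Washington1997, Lemma 1.4] -/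
theorem exists_isPrimitiveRoot_iff_exists_norm_pow_add_lt (hp2 : p ≠ 2) :
    (∃ ζ : K, IsPrimitiveRoot ζ p) ↔ ∃ x : K, ‖x ^ (p - 1) + (p : K)‖ < ‖(p : K)‖ := by
  obtain ⟨ϖ, hϖ⟩ := exists_isUniformizer (F := K)
  have hq0 : p - 1 ≠ 0 := by have := hp.out.two_le; omega
  constructor
  · rintro ⟨ζ, hζ⟩
    have hdvd := pred_dvd_absRamificationIdx_of_isPrimitiveRoot p K hζ
    have he : absRamificationIdx p K = absRamificationIdx p K / (p - 1) * (p - 1) :=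
      (Nat.div_mul_cancel hdvd).symm
    exact (exists_pow_prime_eq_one_ne_one_iff_exists_norm_pow_add_lt_level p hϖ he hp2).mp
      ⟨ζ, hζ.pow_eq_one, hζ.ne_one hp.out.one_lt⟩
  · rintro ⟨x, hx⟩
    -- `‖x‖^{p−1} = ‖p‖ = ‖ϖ‖ᵉ`, so `(p − 1)·ord x = e`
    have hxn : ‖x ^ (p - 1)‖ = ‖(p : K)‖ := by
      have h := norm_add_eq_max_of_norm_ne_norm (x := x ^ (p - 1) + p) (y := -(p : K))
        (by rw [norm_neg]; exact hx.ne)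
      rw [add_neg_cancel_right, norm_neg, max_eq_right hx.le] at h
      exact h
    have hx0 : x ≠ 0 := by
      rintro rfl
      rw [zero_pow hq0, norm_zero] at hxn
      exact (norm_pos_iff.mpr (prime_ne_zero p K)).ne hxn
    obtain ⟨k, hk⟩ := hϖ.2 (Units.mk0 x hx0)
    rw [Units.val_mk0] at hk
    rw [norm_pow, hk, norm_prime_eq_norm_pow p K hϖ, ← zpow_natCast, ← zpow_mul, ← zpow_natCast] at hxn
    have hke : k * ((p - 1 : ℕ) : ℤ) = (absRamificationIdx p K : ℤ) := hϖ.zpow_injective hxn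
    have hk0 : 0 ≤ k := by
      by_contra hneg
      rw [not_le] at hneg
      have h1 : k * ((p - 1 : ℕ) : ℤ) < 0 := mul_neg_of_neg_of_pos hneg (by exact_mod_cast Nat.pos_of_ne_zero hq0)
      rw [hke] at h1
      exact absurd h1 (not_lt.mpr (by positivity))
    have he : absRamificationIdx p K = k.toNat * (p - 1) := by
      have : (absRamificationIdx p K : ℤ) = ((k.toNat * (p - 1) : ℕ) : ℤ) := by
        rw [← hke]; push_cast [Int.toNat_of_nonneg hk0]; ring
      exact_mod_cast this
    obtain ⟨ζ, hζ, hζ1⟩ :=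
      (exists_pow_prime_eq_one_ne_one_iff_exists_norm_pow_add_lt_level p hϖ he hp2).mpr ⟨x, hx⟩
    have hord : orderOf ζ = p := orderOf_eq_prime hζ hζ1
    exact ⟨ζ, hord ▸ IsPrimitiveRoot.orderOf ζ⟩

end RootsAnyIndex

end FirstTieLevel

end Literature.IUT.LogVolume

end
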